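import Literature.Geometry.Kaehler.HodgeStarProofs

/-!
# The pointwise Hodge star: the contraction characterisation (proof)

This file discharges the named fact `Literature.Geometry.Kaehler.hodgeStar_apply_eq_alternatingFormInner` of
`Literature/Geometry/Kaehler/HodgeStar.lean`:

* `Literature.hodgeStar_apply_eq_alternatingFormInner_holds : hodgeStar_apply_eq_alternatingFormInner o` —
  on `k`-forms of an oriented `n`-dimensional real inner product space, `k + m = n`, the Hodge star
  is computed by contraction against the volume form: `(⋆β)(w) = (-1)^{km} ⟪β, ι_w vol⟫` for
  `w : Fin m → V`, where `ι_w vol` is the `k`-form `vol(w, ·)`.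

This is the wedge-free form of Warner's characterisation of `*` (Warner, *Foundations of
Differentiable Manifolds and Lie Groups*, GTM 94, Ch. 2, Exercise 13): `*(e₁ ∧ ⋯ ∧ e_p) =
± e_{p+1} ∧ ⋯ ∧ eₙ` for *every* orthonormal basis `e₁, …, eₙ` of `V`, with `+` iff `e₁ ∧ ⋯ ∧ eₙ`
lies in the orientation (eq. (3), p. 79), whence `⟨v, w⟩ = *(w ∧ *v) = *(v ∧ *w)` (eq. (6), p. 80),
the pointwise form of `⟨α, β⟩ = ∫ α ∧ *β` (6.1 (5), p. 220). In the model of `HodgeStar.lean`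
(Mathlib has no wedge product of alternating maps) the right-hand sides are contractions:
for the dual basis `k`-form `e^t` of an increasing multi-index `t`, `⋆e^t = vol(b ∘ e t, ·)`, so
`(⋆β)(b ∘ e t) = ⟪⋆β, e^t⟫ = (-1)^{km} ⟪β, ⋆e^t⟫ = (-1)^{km} ⟪β, ι_{b ∘ e t} vol⟫`.

## Proof

With `b = stdOrthonormalBasisFin V n` and `b ∘ e s` the increasing basis tuple of
`s : Set.powersetCard (Fin n) k`, both sides are sums over `s`:
`(⋆β)(w) = ∑ₛ β(b ∘ e s) · vol([b ∘ e s | w])` (`hodgeStar_apply`) and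
`⟪β, ι_w vol⟫ = ∑ₛ β(b ∘ e s) · vol([w | b ∘ e s])` (`alternatingFormInner_apply`,
`interiorProductMulti_apply`), where `[u | u'] = Fin.append u u' ∘ Fin.cast _`. The claim therefore
reduces, multi-index by multi-index, to `vol([v | w]) = (-1)^{km} vol([w | v])`: by
`HodgeStarAux.append_cast_swap`, `[w | v] = [v | w] ∘ ρᵏ` for the basic rotation `ρ = finRotate n`,
whose `k`-th power has sign `(-1)^{km}` (`HodgeStarAux.sign_finRotate_pow`), and the volume form is
alternating (`AlternatingMap.map_perm`); finally `(-1)^{km} (-1)^{km} = 1`. (The same block-swap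
identity, stated for the contractions, is `HodgeStarAux.interiorProductMulti_volumeFormL_swap` of
`HodgeStarBasisProofs.lean`.)

## References

* F. W. Warner, *Foundations of Differentiable Manifolds and Lie Groups*, GTM 94, Springer (1983),
  Ch. 2, Exercise 13, pp. 79–80 (the star operator `*`: eq. (3)
  `*(e₁ ∧ ⋯ ∧ e_p) = ± e_{p+1} ∧ ⋯ ∧ eₙ`, eq. (5) `** = (-1)^{p(n-p)}`, eq. (6)
  `⟨v, w⟩ = *(w ∧ *v) = *(v ∧ *w)`), and 6.1 Definitions, eq. (5) `⟨α, β⟩ = ∫ α ∧ *β`, p. 220.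
-/

noncomputable section

open Module ContinuousAlternatingMap Function Set.powersetCard

namespace Literature.Geometry.Kaehler

section HodgeStarInner

open HodgeStarAux

variable {V : Type*} [NormedAddCommGroup V] [InnerProductSpace ℝ V] [FiniteDimensional ℝ V]
  {n : ℕ} [Fact (finrank ℝ V = n)] (o : Orientation ℝ V (Fin n)) {k m : ℕ}

/-- **Discharge of `hodgeStar_apply_eq_alternatingFormInner`**: the contraction characterisation
of the Hodge star on `k`-forms of an oriented `n`-dimensional real inner product space,
`(⋆β)(w) = (-1)^{km} ⟪β, ι_w vol⟫` for `w : Fin m → V`, `k + m = n`, where `ι_w vol` is the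
`k`-form `vol(w, ·)`. Warner, *Foundations of Differentiable Manifolds and Lie Groups*, Ch. 2,
Exercise 13 characterises `*` by `*(e₁ ∧ ⋯ ∧ e_p) = ± e_{p+1} ∧ ⋯ ∧ eₙ` for *any* orthonormal
basis, `+` iff `e₁ ∧ ⋯ ∧ eₙ` lies in the orientation (eq. (3), p. 79), whence
`⟨v, w⟩ = *(w ∧ *v) = *(v ∧ *w)` (eq. (6), p. 80; the pointwise form of 6.1 (5), p. 220); the
fact is the wedge-free (contraction) form of this characterisation:
`(⋆β)(b ∘ e t) = ⟪⋆β, e^t⟫ = (-1)^{km} ⟪β, ⋆e^t⟫` with `⋆e^t = vol(b ∘ e t, ·)`. Proof: unfolding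
both sides (`hodgeStar_apply`, `alternatingFormInner_apply`, `interiorProductMulti_apply`) reduces
the claim, multi-index by multi-index, to `vol([b ∘ e s | w]) = (-1)^{km} vol([w | b ∘ e s])`,
which is the sign `(-1)^{km}` of the block rotation `ρᵏ` (`append_cast_swap`,
`sign_finRotate_pow`, `AlternatingMap.map_perm`).
[cite: WarnerGTM94, Ch. 2 Ex. 13 (3) and (6), pp. 79–80; 6.1 (5), p. 220] -/
theorem hodgeStar_apply_eq_alternatingFormInner_holds :
    hodgeStar_apply_eq_alternatingFormInner o (k := k) (m := m) := by
  intro h β w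
  have h' : m + k = n := by omega
  rw [hodgeStar_apply, alternatingFormInner_apply, Finset.mul_sum]
  refine Finset.sum_congr rfl fun s _ ↦ ?_
  rw [mul_left_comm]
  congr 1
  rw [interiorProductMulti_apply, interiorProductMulti_apply, domDomCongr_apply, domDomCongr_apply,
    Orientation.volumeFormL_apply, Orientation.volumeFormL_apply]
  -- both block tuples as `[u | u'] = Fin.append u u' ∘ Fin.cast _`
  have e1 : (Fin.append ((stdOrthonormalBasisFin V n).multiIndex s) w ∘
      Fin.cast (Nat.add_comm m k)) ∘ ⇑(finCongr (show n = m + k by omega)) =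
        Fin.append ((stdOrthonormalBasisFin V n).multiIndex s) w ∘ Fin.cast h.symm := by
    funext i
    simp only [comp_apply, finCongr_apply, Fin.cast_cast]
  have e2 : (Fin.append w ((stdOrthonormalBasisFin V n).multiIndex s) ∘
      Fin.cast (Nat.add_comm k m)) ∘ ⇑(finCongr (show n = k + m by omega)) =
        Fin.append w ((stdOrthonormalBasisFin V n).multiIndex s) ∘ Fin.cast h'.symm := by
    funext i
    simp only [comp_apply, finCongr_apply, Fin.cast_cast]
  -- `[w | v] = [v | w] ∘ ρᵏ`, `sign ρᵏ = (-1)^{km}`, and `(-1)^{km} (-1)^{km} = 1`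
  rw [e1, e2, append_cast_swap h h', AlternatingMap.map_perm, Units.smul_def, zsmul_eq_mul,
    sign_finRotate_pow h, Int.cast_pow, Int.cast_neg, Int.cast_one, ← mul_assoc, ← pow_add,
    ← two_mul, pow_mul, neg_one_sq, one_pow, one_mul]

end HodgeStarInner

end Literature.Geometry.Kaehler
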